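import Summits.QuantumFields.BalabanUV.Beta.GAN24.TorusCovering

/-!
# G-an2-4 ∕ (CONV-C), INTERFACE REQUEST #12 (B5-1115-TABLE), row F12-E2r — supplier (C):
# THE DECK SUM OF AN EXPONENTIALLY DECAYING BLOCK KERNEL ALONG A COVERING OF TORI, CONSTANTS DEPENDING ON `d` AND THE RATE ONLY

G-an2-4 formalisation swarm `b2b-balaban-gan24-formalise-*`, leaf prover 02 (gen 42), crux team (2) under the coordinator ruling
«YM REDIRECT» (e34b3e0c); § II.F of `GAN24/Formal/LEAVES.md`, row **F12-E2r** (the RECTANGULAR-torus half of (E2)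
`B5Prop12Entries110.Entry110Grad d 1`), ROAD (r2) «covering ∕ periodisation bridge».  When a block kernel on the covering torus
`Π_μ ℤ/M′_μ` decays like `e^{−δ·|t − ỹ′|_{T′,∞}}` in the block distance, its sum over the DECK of a base block `y′ ∈ Π_μ ℤ/M_μ`
(all `ỹ′` over `y′`) decays like `e^{−(δ/(d+1))·|t − y′|_{T,∞}}` in the base distance, with the constant
`B4TorusKernel.periodConst δ d = (2e^{δ/(d+1)}/(1 − e^{−δ/(d+1)}))^{d+1}` — independent of BOTH period vectors.

## Contents (0 `def`, 0 `def … : Prop`, 0 cite, 0 sorry)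
* §1 one residue class on the line: `tsum_exp_translate_le` (`Σ_{m∈ℤ} e^{−κ|y + Nm|} ≤ (2e^{κ}/(1−e^{−κ}))·e^{−κ|y|}` for a centred `y`,
  from `B4TorusKernel.exp_translate_le` + `summable_geometric_int` BY NAME), `sum_exp_le_of_injOn` (any finite family of DISTINCT points
  of the class).
* §2 one coordinate of the covering: **`fibre_sum_exp_circAbs_le`** — for `N ∣ N′`, `c ∈ ℤ/N`, `t ∈ ℤ`:
  `Σ_{z ∈ ℤ/N′, z ↦ c} e^{−κ·dist(t − z, N′ℤ)} ≤ (2e^{κ}/(1−e^{−κ}))·e^{−κ·dist(t − c, Nℤ)}` (the centred lifts of the `N′/N` terms are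
  pairwise distinct points of the class `t − c + Nℤ`).
* §3 the torus: `exp_torusSupNorm_le_prod`, `torusSupNorm_le_sum_circAbs`, `fibre_eq_piFinset`, and the END **`deck_sum_le`**:
  `Σ_{ỹ : cov ỹ = y} e^{−δ·torusSupNorm M′ (t − rep ỹ)} ≤ periodConst δ d · e^{−(δ/(d+1))·torusSupNorm M (t − rep y)}`.

HONEST SCOPE.  Elementary real analysis ([folklore]); nothing of [B5] asserted; no lattice operator appears.  NOT (E2), NOT (CONV-C), NEVER
«G-an2-4 closed», NOT NE2, NOT D1, NOT BetaPertH, NOT continuum, NOT Clay; not in print — our bookkeeping.  HONEST DEPENDENCY: continuum YM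
on T⁴ ⇐ BetaPertH ∧ nine spine estimates (0/9 proved); BetaPertH ⇐ (D1) ∧ (D4) ∧ CAP+tail; G-an2-4 gates asym, D1 and NE2/3/4.
-/

noncomputable section

open scoped BigOperators
open Finset

namespace Summit.QuantumFields.BalabanUV.Beta.GAN24.TorusCoveringDeckSum

open Literature.MathematicalPhysics.QuantumFieldTheory.Balaban1983to89
open B5Prop11Plancherel (Tor)
open B4TorusKernel (summable_geometric_int exp_translate_le periodConst)
open B4TorusKernel.MultiPeriod (circAbs centre circAbs_nonneg two_mul_circAbs_le circAbs_add_mul abs_add_mul_centre torusSupNorm)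
open B6LowerBound2153Torus (rep)
open TorusCovering (cov)

variable {d : ℕ}

/-! ## §1 One residue class on the line -/

/-- `Σ_{m ∈ ℤ} e^{−κ|y + N m|}` converges and is at most `(2e^{κ}/(1 − e^{−κ}))·e^{−κ|y|}` for a centred representative `2|y| ≤ N`,
`N ≥ 1`, `κ > 0`. [folklore] -/
theorem tsum_exp_translate_le {κ : ℝ} (hκ : 0 < κ) (y : ℤ) {N : ℕ} (hN : 1 ≤ N) (hy : 2 * |y| ≤ N) :
    Summable (fun m : ℤ => Real.exp (-(κ * |((y + N * m : ℤ) : ℝ)|))) ∧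
      ∑' m : ℤ, Real.exp (-(κ * |((y + N * m : ℤ) : ℝ)|))
        ≤ 2 * Real.exp κ / (1 - Real.exp (-κ)) * Real.exp (-(κ * |(y : ℝ)|)) := by
  set r := Real.exp (-κ) with hr
  have hr0 : 0 ≤ r := (Real.exp_pos _).le
  have hr1 : r < 1 := Real.exp_lt_one_iff.mpr (by linarith)
  obtain ⟨hgs, hgle⟩ := summable_geometric_int hr0 hr1
  set A := Real.exp κ * Real.exp (-(κ * |(y : ℝ)|)) with hA
  have hle : ∀ m : ℤ, Real.exp (-(κ * |((y + N * m : ℤ) : ℝ)|)) ≤ A * r ^ m.natAbs := fun m =>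
    exp_translate_le hκ.le y m hN hy
  have hmaj : Summable (fun m : ℤ => A * r ^ m.natAbs) := hgs.mul_left A
  have hs : Summable (fun m : ℤ => Real.exp (-(κ * |((y + N * m : ℤ) : ℝ)|))) :=
    Summable.of_nonneg_of_le (fun m => (Real.exp_pos _).le) hle hmaj
  refine ⟨hs, ?_⟩
  have hA0 : 0 ≤ A := by positivity
  calc ∑' m : ℤ, Real.exp (-(κ * |((y + N * m : ℤ) : ℝ)|)) ≤ ∑' m : ℤ, A * r ^ m.natAbs :=
        hs.tsum_le_tsum hle hmaj
    _ = A * ∑' m : ℤ, r ^ m.natAbs := tsum_mul_left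
    _ ≤ A * (2 / (1 - r)) := mul_le_mul_of_nonneg_left hgle hA0
    _ = 2 * Real.exp κ / (1 - Real.exp (-κ)) * Real.exp (-(κ * |(y : ℝ)|)) := by rw [hA, hr]; ring

/-- a finite family of pairwise DISTINCT points `y + N·m(s)` of one residue class sums to at most the whole class:
`Σ_{s ∈ S} e^{−κ|y + N m(s)|} ≤ (2e^{κ}/(1 − e^{−κ}))·e^{−κ|y|}` (`m` injective on `S`, `y` centred). [folklore] -/
theorem sum_exp_le_of_injOn {κ : ℝ} (hκ : 0 < κ) (y : ℤ) {N : ℕ} (hN : 1 ≤ N) (hy : 2 * |y| ≤ N)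
    {α : Type*} (S : Finset α) (m : α → ℤ) (hm : Set.InjOn m S) :
    ∑ s ∈ S, Real.exp (-(κ * |((y + N * m s : ℤ) : ℝ)|))
      ≤ 2 * Real.exp κ / (1 - Real.exp (-κ)) * Real.exp (-(κ * |(y : ℝ)|)) := by
  obtain ⟨hs, hle⟩ := tsum_exp_translate_le hκ y hN hy
  calc ∑ s ∈ S, Real.exp (-(κ * |((y + N * m s : ℤ) : ℝ)|))
      = ∑ j ∈ S.image m, Real.exp (-(κ * |((y + N * j : ℤ) : ℝ)|)) := by rw [Finset.sum_image hm]
    _ ≤ ∑' j : ℤ, Real.exp (-(κ * |((y + N * j : ℤ) : ℝ)|)) :=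
        hs.sum_le_tsum (S.image m) (fun j _ => (Real.exp_pos _).le)
    _ ≤ _ := hle

/-! ## §2 One coordinate of the covering -/

/-- **THE FIBRE SUM IN ONE COORDINATE**: for `N ∣ N′`, a class `c ∈ ℤ/N`, `t ∈ ℤ` and `κ > 0`,
`Σ_{z ∈ ℤ/N′ : z ↦ c} e^{−κ·dist(t − v(z), N′ℤ)} ≤ (2e^{κ}/(1 − e^{−κ}))·e^{−κ·dist(t − v(c), Nℤ)}` — the `N′/N` centred lifts
`(t − v(z)) + N′·centre` are pairwise distinct integers of the class `t − v(c) + Nℤ`. [folklore] -/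
theorem fibre_sum_exp_circAbs_le {κ : ℝ} (hκ : 0 < κ) {N N' : ℕ} [NeZero N] [NeZero N'] (hNN : N ∣ N')
    (c : ZMod N) (t : ℤ) :
    ∑ z ∈ Finset.univ.filter (fun z : ZMod N' => ZMod.castHom hNN (ZMod N) z = c),
        Real.exp (-(κ * ((circAbs N' (t - (z.val : ℤ)) : ℤ) : ℝ)))
      ≤ 2 * Real.exp κ / (1 - Real.exp (-κ)) * Real.exp (-(κ * ((circAbs N (t - (c.val : ℤ)) : ℤ) : ℝ))) := by
  have hN : 1 ≤ N := Nat.one_le_iff_ne_zero.mpr (NeZero.ne N)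
  have hN' : 1 ≤ N' := Nat.one_le_iff_ne_zero.mpr (NeZero.ne N')
  obtain ⟨k, hk⟩ := hNN
  have hkZ : (N' : ℤ) = N * k := by exact_mod_cast hk
  set r : ℤ := t - (c.val : ℤ) with hr
  set y : ℤ := r + N * centre N r with hy
  have hyabs : |y| = circAbs N r := abs_add_mul_centre hN r
  have hyc : 2 * |y| ≤ N := by rw [hyabs]; exact two_mul_circAbs_le N r
  -- the label of a term: the multiple of `N` separating its centred lift from `y`
  set m : ZMod N' → ℤ := fun z => -((z.val : ℤ) / N) + k * centre N' (t - (z.val : ℤ)) - centre N r with hm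
  set S := Finset.univ.filter (fun z : ZMod N' => ZMod.castHom ⟨k, hk⟩ (ZMod N) z = c) with hS
  have hval : ∀ z ∈ S, (z.val : ℤ) - c.val = N * ((z.val : ℤ) / N) := by
    intro z hz
    have hz' : ZMod.castHom ⟨k, hk⟩ (ZMod N) z = c := (Finset.mem_filter.mp hz).2
    rw [ZMod.castHom_apply, ZMod.cast_eq_val] at hz'
    have h1 : c.val = z.val % N := by rw [← hz', ZMod.val_natCast]
    have h2 : ((N * (z.val / N) + z.val % N : ℕ) : ℤ) = (z.val : ℤ) := by exact_mod_cast Nat.div_add_mod z.val N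
    push_cast at h2
    rw [h1]
    push_cast
    linarith
  have hum : ∀ z ∈ S, (t - (z.val : ℤ)) + N' * centre N' (t - (z.val : ℤ)) = y + N * m z := by
    intro z hz
    have hv := hval z hz
    simp only [hm, hy, hr]
    linear_combination (-1 : ℤ) * hv + (centre N' (t - (z.val : ℤ))) * hkZ
  have hm_inj : Set.InjOn m S := by
    intro z hz z' hz' hzz
    have hu := hum z hz
    have hu' := hum z' hz'
    rw [hzz] at hu
    have huu : (t - (z.val : ℤ)) + N' * centre N' (t - (z.val : ℤ))
        = (t - (z'.val : ℤ)) + N' * centre N' (t - (z'.val : ℤ)) := by rw [hu, hu']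
    have e : (((z.val : ℤ) : ZMod N')) = (((z'.val : ℤ) : ZMod N')) := by
      rw [ZMod.intCast_eq_intCast_iff_dvd_sub]
      exact ⟨centre N' (t - (z'.val : ℤ)) - centre N' (t - (z.val : ℤ)), by linear_combination huu⟩
    simp only [Int.cast_natCast, ZMod.natCast_zmod_val] at e
    exact e
  calc ∑ z ∈ S, Real.exp (-(κ * ((circAbs N' (t - (z.val : ℤ)) : ℤ) : ℝ)))
      = ∑ z ∈ S, Real.exp (-(κ * |((y + N * m z : ℤ) : ℝ)|)) := by
        refine Finset.sum_congr rfl fun z hz => ?_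
        rw [← abs_add_mul_centre hN' (t - (z.val : ℤ)), hum z hz, Int.cast_abs]
    _ ≤ 2 * Real.exp κ / (1 - Real.exp (-κ)) * Real.exp (-(κ * |(y : ℝ)|)) :=
        sum_exp_le_of_injOn hκ y hN hyc S m hm_inj
    _ = 2 * Real.exp κ / (1 - Real.exp (-κ)) * Real.exp (-(κ * ((circAbs N r : ℤ) : ℝ))) := by
        rw [← hyabs, Int.cast_abs]

/-! ## §3 The torus -/

/-- `e^{−δ·|s|_{T,∞}} ≤ Π_i e^{−(δ/(d+1))·dist(s_i, N_iℤ)}` (the max dominates the mean). [folklore] -/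
theorem exp_torusSupNorm_le_prod {δ : ℝ} (hδ : 0 ≤ δ) (N : Fin (d + 1) → ℕ) (s : Fin (d + 1) → ℤ) :
    Real.exp (-(δ * torusSupNorm N s)) ≤ ∏ i, Real.exp (-(δ / (d + 1) * ((circAbs (N i) (s i) : ℤ) : ℝ))) := by
  rw [← Real.exp_sum]
  apply Real.exp_le_exp.mpr
  rw [Finset.sum_neg_distrib, ← Finset.mul_sum, neg_le_neg_iff]
  have hle : ∑ i, ((circAbs (N i) (s i) : ℤ) : ℝ) ≤ (d + 1) * torusSupNorm N s := by
    calc ∑ i, ((circAbs (N i) (s i) : ℤ) : ℝ) ≤ ∑ _i : Fin (d + 1), torusSupNorm N s :=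
          Finset.sum_le_sum fun i _ =>
            Finset.le_sup' (f := fun i => ((circAbs (N i) (s i) : ℤ) : ℝ)) (Finset.mem_univ i)
      _ = (d + 1) * torusSupNorm N s := by
          rw [Finset.sum_const, Finset.card_univ, Fintype.card_fin, nsmul_eq_mul]; push_cast; ring
  have hd : (0 : ℝ) < d + 1 := by positivity
  calc δ / (d + 1) * ∑ i, ((circAbs (N i) (s i) : ℤ) : ℝ) ≤ δ / (d + 1) * ((d + 1) * torusSupNorm N s) :=
        mul_le_mul_of_nonneg_left hle (div_nonneg hδ hd.le)
    _ = δ * torusSupNorm N s := by field_simp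

/-- `|s|_{T,∞} ≤ Σ_i dist(s_i, N_iℤ)` (all terms nonnegative, `N_i ≥ 1`). [folklore] -/
theorem torusSupNorm_le_sum_circAbs (N : Fin (d + 1) → ℕ) (hN : ∀ i, 1 ≤ N i) (s : Fin (d + 1) → ℤ) :
    torusSupNorm N s ≤ ∑ i, ((circAbs (N i) (s i) : ℤ) : ℝ) := by
  refine Finset.sup'_le _ _ fun i _ => ?_
  exact Finset.single_le_sum (f := fun i => ((circAbs (N i) (s i) : ℤ) : ℝ))
    (fun j _ => by exact_mod_cast circAbs_nonneg (hN j) (s j)) (Finset.mem_univ i)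

/-- the fibre of the covering over `y` is the product of the coordinate fibres. [folklore] -/
theorem fibre_eq_piFinset {M M' : Fin (d + 1) → ℕ} [∀ μ, NeZero (M μ)] [∀ μ, NeZero (M' μ)] (h : ∀ μ, M μ ∣ M' μ)
    (y : Tor M) :
    Finset.univ.filter (fun y' : Tor M' => cov h y' = y)
      = Fintype.piFinset (fun μ => Finset.univ.filter (fun z : ZMod (M' μ) => ZMod.castHom (h μ) (ZMod (M μ)) z = y μ)) := by
  ext y'
  simp only [Finset.mem_filter, Finset.mem_univ, true_and, Fintype.mem_piFinset, cov, funext_iff]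

/-- **THE DECK SUM**: for `M ∣ M′` (coordinatewise), `δ > 0`, every `t ∈ ℤ^{d+1}` and every base point `y ∈ Π_μ ℤ/M_μ`,
`Σ_{ỹ : cov ỹ = y} e^{−δ·|t − rep ỹ|_{T′,∞}} ≤ periodConst δ d · e^{−(δ/(d+1))·|t − rep y|_{T,∞}}` — the constant depends on `d`
and `δ` only. [folklore] -/
theorem deck_sum_le {M M' : Fin (d + 1) → ℕ} [∀ μ, NeZero (M μ)] [∀ μ, NeZero (M' μ)] (h : ∀ μ, M μ ∣ M' μ)
    {δ : ℝ} (hδ : 0 < δ) (t : Fin (d + 1) → ℤ) (y : Tor M) :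
    ∑ y' ∈ Finset.univ.filter (fun y' : Tor M' => cov h y' = y), Real.exp (-(δ * torusSupNorm M' (t - rep M' y')))
      ≤ periodConst δ d * Real.exp (-(δ / (d + 1) * torusSupNorm M (t - rep M y))) := by
  have hM : ∀ i, 1 ≤ M i := fun i => Nat.one_le_iff_ne_zero.mpr (NeZero.ne _)
  set δ' : ℝ := δ / (d + 1) with hδ'
  have hδ'0 : 0 < δ' := div_pos hδ (by positivity)
  set C₁ : ℝ := 2 * Real.exp δ' / (1 - Real.exp (-δ')) with hC₁
  have hC₁0 : 0 ≤ C₁ := by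
    have : Real.exp (-δ') < 1 := Real.exp_lt_one_iff.mpr (by linarith)
    rw [hC₁]; exact div_nonneg (by positivity) (by linarith)
  set f : (i : Fin (d + 1)) → ZMod (M' i) → ℝ :=
    fun i z => Real.exp (-(δ' * ((circAbs (M' i) (t i - (z.val : ℤ)) : ℤ) : ℝ))) with hf
  have hf0 : ∀ i z, 0 ≤ f i z := fun i z => (Real.exp_pos _).le
  -- step 1: each term is dominated by the product of coordinate factors
  have step1 : ∀ y' : Tor M', Real.exp (-(δ * torusSupNorm M' (t - rep M' y'))) ≤ ∏ i, f i (y' i) := fun y' =>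
    exp_torusSupNorm_le_prod hδ.le M' (t - rep M' y')
  -- step 2: the fibre is a product set, the sum of products is the product of the coordinate sums
  have step2 : ∑ y' ∈ Finset.univ.filter (fun y' : Tor M' => cov h y' = y), ∏ i, f i (y' i)
      = ∏ i, ∑ z ∈ Finset.univ.filter (fun z : ZMod (M' i) => ZMod.castHom (h i) (ZMod (M i)) z = y i), f i z := by
    rw [fibre_eq_piFinset, ← Finset.prod_univ_sum]
  -- step 3: coordinate fibre sums
  have step3 : ∀ i, ∑ z ∈ Finset.univ.filter (fun z : ZMod (M' i) => ZMod.castHom (h i) (ZMod (M i)) z = y i), f i z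
      ≤ C₁ * Real.exp (-(δ' * ((circAbs (M i) (t i - ((y i).val : ℤ)) : ℤ) : ℝ))) := fun i =>
    fibre_sum_exp_circAbs_le hδ'0 (h i) (y i) (t i)
  calc ∑ y' ∈ Finset.univ.filter (fun y' : Tor M' => cov h y' = y), Real.exp (-(δ * torusSupNorm M' (t - rep M' y')))
      ≤ ∑ y' ∈ Finset.univ.filter (fun y' : Tor M' => cov h y' = y), ∏ i, f i (y' i) :=
        Finset.sum_le_sum fun y' _ => step1 y'
    _ = ∏ i, ∑ z ∈ Finset.univ.filter (fun z : ZMod (M' i) => ZMod.castHom (h i) (ZMod (M i)) z = y i), f i z := step2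
    _ ≤ ∏ i, C₁ * Real.exp (-(δ' * ((circAbs (M i) (t i - ((y i).val : ℤ)) : ℤ) : ℝ))) :=
        Finset.prod_le_prod (fun i _ => Finset.sum_nonneg fun z _ => hf0 i z) fun i _ => step3 i
    _ = C₁ ^ (d + 1) * Real.exp (-(δ' * ∑ i, ((circAbs (M i) ((t - rep M y) i) : ℤ) : ℝ))) := by
        rw [Finset.prod_mul_distrib, Finset.prod_const, Finset.card_univ, Fintype.card_fin, ← Real.exp_sum,
          Finset.mul_sum, ← Finset.sum_neg_distrib]
        rfl
    _ ≤ periodConst δ d * Real.exp (-(δ' * torusSupNorm M (t - rep M y))) := by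
        have hC : C₁ ^ (d + 1) = periodConst δ d := by rw [hC₁, hδ', periodConst]
        rw [hC]
        have hP : 0 ≤ periodConst δ d := by rw [← hC]; positivity
        apply mul_le_mul_of_nonneg_left _ hP
        apply Real.exp_le_exp.mpr
        have := torusSupNorm_le_sum_circAbs M hM (t - rep M y)
        nlinarith [hδ'0.le]

end Summit.QuantumFields.BalabanUV.Beta.GAN24.TorusCoveringDeckSum

end
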